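import Literature.Geometry.Kaehler.HolomorphicChartForms
import HarnessLib

/-!
# The space `Ω^k(M)` of holomorphic `k`-forms (in charts)

The predicate `Literature.Geometry.Kaehler.IsHolomorphicInCharts` (a complex `k`-form whose
chart representatives are restrictions of scalars of analytic `ℂ`-multilinear germs; Huybrechts,
Def. 2.2.14) is stable under `0`, `+` and complex scalars (`isHolomorphicInCharts_zero`,
`IsHolomorphicInCharts.add`, `IsHolomorphicInCharts.smul`). This file only packages these three
facts as the `ℂ`-submodule `holFormsInCharts E M k ⊆ MForm 𝓘(ℝ, E) M ℂ k` — the space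
`Ω^k(M) = H⁰(M, Ω^k_M)` of global holomorphic `k`-forms (Huybrechts, Def. 2.2.14; Voisin I,
§2.3.1) — so that constructions on holomorphic forms (pull-backs, period maps) can be stated as
`ℂ`-linear maps.

References: D. Huybrechts, *Complex Geometry* (2005), Def. 2.2.14; C. Voisin, *Hodge Theory and
Complex Algebraic Geometry I* (2002), §2.3.1.
-/

noncomputable section

open scoped Manifold ContDiff

namespace Literature.Geometry.Kaehler

variable (E : Type*) [NormedAddCommGroup E] [NormedSpace ℂ E]
  (M : Type*) [TopologicalSpace M] [ChartedSpace E M] (k : ℕ)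

/-- **The space `Ω^k(M)` of holomorphic `k`-forms**, as the `ℂ`-submodule of complex `k`-forms
cut out by `IsHolomorphicInCharts`. [cite: Huybrechts2005, Def. 2.2.14] -/
def holFormsInCharts : Submodule ℂ (MForm 𝓘(ℝ, E) M ℂ k) where
  carrier := {η | IsHolomorphicInCharts η}
  add_mem' hη hη' := hη.add hη'
  zero_mem' := isHolomorphicInCharts_zero
  smul_mem' c _ hη := IsHolomorphicInCharts.smul c hη

variable {E M k}

/-- Membership in `holFormsInCharts` is `IsHolomorphicInCharts`. [folklore] -/
@[simp] theorem mem_holFormsInCharts_iff {η : MForm 𝓘(ℝ, E) M ℂ k} :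
    η ∈ holFormsInCharts E M k ↔ IsHolomorphicInCharts η :=
  Iff.rfl

/-- An element of `Ω^k(M)` is holomorphic in charts. [folklore] -/
theorem isHolomorphicInCharts_of_mem (η : holFormsInCharts E M k) :
    IsHolomorphicInCharts (η : MForm 𝓘(ℝ, E) M ℂ k) :=
  η.2

/-- Holomorphic forms are smooth: `Ω^k(M) ⊆ A^k(M; ℂ)` elementwise
(`IsHolomorphicInCharts.isSmoothForm`). [folklore] -/
theorem isSmoothForm_of_mem (η : holFormsInCharts E M k) :
    IsSmoothForm (η : MForm 𝓘(ℝ, E) M ℂ k) :=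
  η.2.isSmoothForm

/-- Holomorphic `k`-forms have type `(k, 0)` (`IsHolomorphicInCharts.isOfType`; Voisin I, §2.3.1:
`Ω^k ⊆ A^{k,0}`). [cite: Huybrechts2005, Prop. 2.6.11] -/
theorem isOfType_of_mem [IsManifold 𝓘(ℝ, E) ∞ M] (η : holFormsInCharts E M k) :
    Literature.NumberTheory.Transcendental.IsOfType k 0 (η : MForm 𝓘(ℝ, E) M ℂ k) :=
  η.2.isOfType

/-- In top degree `k = dim M`, holomorphic forms are closed smooth forms: the inclusion
`Ω^n(M) →ₗ Z^n(M; ℂ)` (`IsHolomorphicInCharts.mem_cclosedSmoothForms`).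
[cite: VoisinHodgeI2002, Cor. 7.6 (proof, case p = n)] -/
def holFormsInChartsToClosed [FiniteDimensional ℂ E] [IsManifold 𝓘(ℝ, E) ∞ M]
    (hk : Module.finrank ℂ E = k) :
    holFormsInCharts E M k →ₗ[ℂ]
      Literature.NumberTheory.Transcendental.cclosedSmoothForms E M k where
  toFun η := ⟨η, η.2.mem_cclosedSmoothForms hk⟩
  map_add' _ _ := rfl
  map_smul' _ _ := rfl

/-- Unfolding `holFormsInChartsToClosed`. [folklore] -/
@[simp] theorem coe_holFormsInChartsToClosed [FiniteDimensional ℂ E] [IsManifold 𝓘(ℝ, E) ∞ M]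
    (hk : Module.finrank ℂ E = k) (η : holFormsInCharts E M k) :
    (holFormsInChartsToClosed hk η : MForm 𝓘(ℝ, E) M ℂ k) = η :=
  rfl

end Literature.Geometry.Kaehler

end
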